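import Summits.AtomisticToContinuum.FouriersLaw.Theses.BondHeatUncertainty
import Summits.AtomisticToContinuum.FouriersLaw.Theorems.ExtensiveSnapshotIrreversibility.Negative.DegenerateInstances

/-!
# Line `momentum-fisher-maximum-principle` — checked skeleton for crux `ExtensiveSnapshotIrreversibility`
(item stmt-AtomisticToContinuum-9121, route `BondHeatUncertainty` rank 3; crux-plan seat
planner-cruxplan-stmt-AtomisticToContinuum-9121-momentum-fisher-maxi-0, 2026-08-16)

Crux (K): under weak-NESS uniqueness, along every steady-state family `μ` of `pinnedChain ω₂ lam β γ`
(all `> 0`) and every `T > 0` there is `C` with, for every `N`, eventually as `δ → 0, δ ≠ 0`,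
`KL(μ_{N,T+δ/2,T-δ/2} ‖ Θ_* μ_{N,T+δ/2,T-δ/2}) ≤ C·N·δ²`, `Θ(q,p) = (q,-p)`.

Line (card `Ideas/momentum-fisher-maximum-principle.md`, triage r1-1/2/3: pass).  Notation:
`μ_T := gibbsMeasure N T` (Gibbs at the mean temperature = the equilibrium member of the family under
the guard), `h` the LINEAR-RESPONSE DENSITY of the family at `T` (`dμ_δ = (1 + δh + o(δ)) dμ_T`, typed by
the first-order interface of `OddSectorIrreversibility.ResponseDensity`), `h_o := (h − h∘Θ)/2` its `Θ`-odd
part, `ι_i := ‖∂_{p_i} h‖²_{L²(μ_T)}` the MOMENTUM SENSITIVITY of site `i`, `ι_i^odd := ‖∂_{p_i} h_o‖² =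
‖((∂_{p_i}h) + (∂_{p_i}h)∘Θ)/2‖²` its odd-sector part, `ι_∂ := ι_0 + ι_{N−1}` the contact (driven-site)
sensitivity.  The chain of the line:

  `limsup δ⁻² KL(μ_δ‖Θμ_δ) ≤ 2‖h_o‖²`                      (`stub_klUpperBound`, fixed `N`)
  `‖h_o‖² ≤ 2T Σ_i ι_i^odd`                                (`stub_oddFibrePoincare`, Gaussian momentum fibre)
  `ι_i^odd ≤ C_mp · ι_∂` for every site `i`                (`stub_sensitivityMaximumPrinciple`, THE residual)
  `ι_∂ ≤ 1/(2T³)`                                          (`stub_contactAnchor`, fixed `N`, entropy balance)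
  `h` exists with `h ∈ C¹`, `∂_p h ∈ L²(μ_T)`              (`stub_regularResponseDensity`, fixed `N`)
  ⟹ `limsup δ⁻² KL ≤ 2·2T·N·C_mp/(2T³) = (2C_mp/T²)·N`, i.e. (K) with `C = 2 max C_mp 0 / T² + 1`;
  `N = 0, 1` from the landed Negative lemmas `extensiveSnapshotIrreversibility_bound_at_zero/_at_one`.

Registered stubs: FIVE (`stub_regularResponseDensity`, `stub_klUpperBound`, `stub_oddFibrePoincare`,
`stub_contactAnchor`, `stub_sensitivityMaximumPrinciple`); the skeleton theorem
`ExtensiveSnapshotIrreversibility_of : ExtensiveSnapshotIrreversibility` concludes the crux BY NAME and invokes the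
stubs by name; its proof has no `sorry` of its own (with the stubs as hypotheses the term is closed, axioms
`propext/Classical.choice/Quot.sound` — checked).  All stub signatures are spelled out in tree vocabulary
(`pinnedChain`, `IsSteadyState`, `gibbsMeasure`, `partialP`, `bondCurrent`, Mathlib `MemLp`/`klDiv`), no local
definitions, so that workers can land them under `Theorems/` with Literature-only imports.

Triage sharpenings acted on: (r1-2) the residual is consumed only in SUMMED form over sites, and (r1-3) it is
typed for the ODD sensitivity `ι^odd` (two orders of slack away from the harmonic corner), compared with the FULL
contact sensitivity `ι_∂` that the entropy-production anchor controls — so no projection-contraction lemma and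
no anharmonicity enter the composition; (r1-1) only the weak/relative maximum principle `∃ C` is filed (the strict
"maximum AT a driven site" is false at `γ ≤ 0.2`, harmonic check), never a numerical constant.

Disproof used (`Cruxes/ExtensiveSnapshotIrreversibility/Disproof.lean`, cdisprove cycle 1–2, NO KILL): honours
`extensiveSnapshotIrreversibility_false_without_family` (every family-dependent stub carries the steady-family
hypothesis and ties `h` to `μ` through the response interface), `_false_without_Tpos` / `_false_with_T_nonneg`
(`0 < T` is the Poincaré constant in `stub_oddFibrePoincare` and the `T⁻³` of `stub_contactAnchor`; the produced
constant scales like `T⁻²`, matching the Disproof's exact harmonic `K_N(T) = K_N(1)/T²` and its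
`StrengtheningUniformT` note), `false_withAllDelta` (everything is eventually-in-`δ`), §4 `StrengtheningBounded`
(no stub uses `lam, β > 0` beyond NESS technology, so the line proves `C·N`, never `O(1)` — consistent with the
ballistic corner `K_N = N/6 − 2/9`, where Poincaré is an equality and the sensitivity profile is a flat plateau);
landed Negative lemmas used positively: `DegenerateInstances` (`N = 0, 1`).  No stub is an instance of a landed
Negative lemma (none concerns Dirac families, `T ≤ 0`, or `∀ δ`).  No `-- Targets` section names these stubs yet.
-/

noncomputable section

namespace Summit.AtomisticToContinuum.FouriersLaw.Cruxes.ExtensiveSnapshotIrreversibility.MomentumFisherMaximumPrinciple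

open MeasureTheory Filter
open scoped ENNReal BigOperators ContDiff
open Literature.MathematicalPhysics.KineticTheory.HeatConduction
open Summit.AtomisticToContinuum.FouriersLaw.Theorems.ExtensiveSnapshotIrreversibility.Negative

/-! ## The five registered stubs -/

/-- **Stub 1 — regular response density (fixed `N`, difficulty L).**  Under the guard, for every steady-state
family, `T > 0` and `N ≥ 2` there is a linear-response density `h` of `δ ↦ μ_{N,T+δ/2,T−δ/2}` at `δ = 0` relative
to the Gibbs state `μ_T` (weak derivative on `C_c^∞` observables AND on the bond currents, `h ∈ L²(μ_T)` — the
interface of `OddSectorIrreversibility.ResponseDensity`) which is moreover `C¹` with momentum gradient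
`∂_{p_i} h ∈ L²(μ_T)` for every site.  Content: Hairer–Majda linear response for the hypoelliptic chain (CEHR 2018
Lyapunov structure) plus ONE derivative of hypoelliptic regularity in `L²(μ_T)` (Villani 2009 §7/§9-type `H¹`
estimates at fixed `N`; `h = Θ(−L)⁻¹ g`, `g = γ(p_0² − p_{N−1}²)/(2T²)`).  `N`-uniformity is NOT asked here. -/
theorem stub_regularResponseDensity :
    ∀ ω₂ lam β γ : ℝ, 0 < ω₂ → 0 < lam → 0 < β → 0 < γ →
          (∀ (N : ℕ) (T_L T_R : ℝ), 0 < T_L → 0 < T_R → ∀ μ ν : Measure (PhaseSpace N),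
            (pinnedChain ω₂ lam β γ).IsSteadyState N T_L T_R μ → (pinnedChain ω₂ lam β γ).IsSteadyState N T_L T_R ν → μ = ν) →
          ∀ μ : (N : ℕ) → ℝ → ℝ → Measure (PhaseSpace N),
            (∀ (N : ℕ) (T_L T_R : ℝ), 0 < T_L → 0 < T_R → (pinnedChain ω₂ lam β γ).IsSteadyState N T_L T_R (μ N T_L T_R)) →
            ∀ T : ℝ, 0 < T →
            ∀ N : ℕ, 2 ≤ N → ∃ h : PhaseSpace N → ℝ,
              (MemLp h 2 ((pinnedChain ω₂ lam β γ).gibbsMeasure N T) ∧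
                (∀ F : PhaseSpace N → ℝ, ContDiff ℝ ((⊤ : ℕ∞) : WithTop ℕ∞) F → HasCompactSupport F →
                  Tendsto (fun δ : ℝ => ((∫ x, F x ∂(μ N (T + δ / 2) (T - δ / 2))) - ∫ x, F x ∂((pinnedChain ω₂ lam β γ).gibbsMeasure N T)) / δ)
                    (nhdsWithin 0 {(0 : ℝ)}ᶜ) (nhds (∫ x, F x * h x ∂((pinnedChain ω₂ lam β γ).gibbsMeasure N T)))) ∧
                (∀ i : Fin N, Tendsto (fun δ : ℝ => ((∫ x, (pinnedChain ω₂ lam β γ).bondCurrent N i x ∂(μ N (T + δ / 2) (T - δ / 2))) -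
                    ∫ x, (pinnedChain ω₂ lam β γ).bondCurrent N i x ∂((pinnedChain ω₂ lam β γ).gibbsMeasure N T)) / δ)
                    (nhdsWithin 0 {(0 : ℝ)}ᶜ) (nhds (∫ x, (pinnedChain ω₂ lam β γ).bondCurrent N i x * h x ∂((pinnedChain ω₂ lam β γ).gibbsMeasure N T))))) ∧
              ContDiff ℝ 1 h ∧ (∀ i : Fin N, MemLp (fun x => partialP i h x) 2 ((pinnedChain ω₂ lam β γ).gibbsMeasure N T)) := by
  sorry

/-- **Stub 2 — snapshot `KL` at second order, upper half (fixed `N`, difficulty L).**  For every `N` and every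
response density `h` (interface as in Stub 1, no extra regularity):
`limsup_{δ→0} δ⁻² KL(μ_δ ‖ Θ_*μ_δ) ≤ 2‖h_o‖²_{L²(μ_T)} = ½∫(h − h∘Θ)² dμ_T`, written as an eventual bound for every
`K` above the sharp constant.  (= the upper half of `OddSectorIrreversibility.ReversalKLSecondOrder`, stated
without `toReal` so that `KL = ∞` is excluded, not hidden.)  Content: second-order expansion of the smooth positive
NESS density in `δ` (CEHR Thm 2.13(1) smoothness/positivity; KNST 2011 `S_sym − S_Sh = ½ KL`); first order cancels,
the `Θ`-invariance of `μ_T` (`gibbsMeasure_map_flip`, landed) kills `∫(h² − (h∘Θ)²)`. -/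
theorem stub_klUpperBound :
    ∀ ω₂ lam β γ : ℝ, 0 < ω₂ → 0 < lam → 0 < β → 0 < γ →
          (∀ (N : ℕ) (T_L T_R : ℝ), 0 < T_L → 0 < T_R → ∀ μ ν : Measure (PhaseSpace N),
            (pinnedChain ω₂ lam β γ).IsSteadyState N T_L T_R μ → (pinnedChain ω₂ lam β γ).IsSteadyState N T_L T_R ν → μ = ν) →
          ∀ μ : (N : ℕ) → ℝ → ℝ → Measure (PhaseSpace N),
            (∀ (N : ℕ) (T_L T_R : ℝ), 0 < T_L → 0 < T_R → (pinnedChain ω₂ lam β γ).IsSteadyState N T_L T_R (μ N T_L T_R)) →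
            ∀ T : ℝ, 0 < T →
            ∀ (N : ℕ) (h : PhaseSpace N → ℝ),
              (MemLp h 2 ((pinnedChain ω₂ lam β γ).gibbsMeasure N T) ∧
                (∀ F : PhaseSpace N → ℝ, ContDiff ℝ ((⊤ : ℕ∞) : WithTop ℕ∞) F → HasCompactSupport F →
                  Tendsto (fun δ : ℝ => ((∫ x, F x ∂(μ N (T + δ / 2) (T - δ / 2))) - ∫ x, F x ∂((pinnedChain ω₂ lam β γ).gibbsMeasure N T)) / δ)
                    (nhdsWithin 0 {(0 : ℝ)}ᶜ) (nhds (∫ x, F x * h x ∂((pinnedChain ω₂ lam β γ).gibbsMeasure N T)))) ∧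
                (∀ i : Fin N, Tendsto (fun δ : ℝ => ((∫ x, (pinnedChain ω₂ lam β γ).bondCurrent N i x ∂(μ N (T + δ / 2) (T - δ / 2))) -
                    ∫ x, (pinnedChain ω₂ lam β γ).bondCurrent N i x ∂((pinnedChain ω₂ lam β γ).gibbsMeasure N T)) / δ)
                    (nhdsWithin 0 {(0 : ℝ)}ᶜ) (nhds (∫ x, (pinnedChain ω₂ lam β γ).bondCurrent N i x * h x ∂((pinnedChain ω₂ lam β γ).gibbsMeasure N T))))) →
              ∀ K : ℝ, 2 * (∫ x, ((h x - h (x.1, -x.2)) / 2) ^ 2 ∂((pinnedChain ω₂ lam β γ).gibbsMeasure N T)) < K →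
                ∀ᶠ δ in nhdsWithin (0 : ℝ) {(0 : ℝ)}ᶜ,
                  InformationTheory.klDiv (μ N (T + δ / 2) (T - δ / 2))
                    (Measure.map (fun x : PhaseSpace N => (x.1, -x.2)) (μ N (T + δ / 2) (T - δ / 2))) ≤ ENNReal.ofReal (K * δ ^ 2) := by
  sorry

/-- **Stub 3 — fibrewise Gaussian Poincaré for the odd part (provable now, difficulty M).**  For ANY oscillator
chain `Q`, `N`, `T > 0` and `f ∈ C¹ ∩ L²(μ_T)` with `∂_p f ∈ L²(μ_T)`, `μ_T = volume.tilted(−H/T)`,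
`H = Σ p²/2 + Φ(q)`: `‖f_o‖² ≤ 2T · Σ_i ‖∂_{p_i} f_o‖²`, where `f_o = (f − f∘Θ)/2` and
`∂_{p_i} f_o = ((∂_{p_i} f) + (∂_{p_i} f)∘Θ)/2`.  Proof: under `μ_T` the momenta are i.i.d. `N(0,T)` given `q`
(`hamiltonian_eq_kinetic_add_potential`), `f_o(q,·)` is odd hence fibre-centred, and the Gaussian Poincaré
inequality is dimension-free with constant `∝ T`: the SHARP constant is `T` (Bakry–Gentil–Ledoux 2014
Prop. 4.1.1; equality for `p`-linear `f_o`, i.e. at the harmonic corner — checked to all digits, triage r1-1/2);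
the tree's rotation-argument version `Literature.Probability.Distributions.lintegral_sq_sub_le_pi_gaussianReal` /
`variance_le_pi_gaussianReal` (PROVED) gives `π²/8 · T < 2T`, which is the constant registered here since the
line consumes only SOME constant; then integrate over the `q`-marginal (disintegration of `volume.tilted`).  If
`e^{−H/T}` is not integrable, `μ_T = 0` and both sides vanish. -/
theorem stub_oddFibrePoincare :
    ∀ (Q : OscillatorChain) (N : ℕ) (T : ℝ), 0 < T → ∀ f : PhaseSpace N → ℝ,
          ContDiff ℝ 1 f → MemLp f 2 (Q.gibbsMeasure N T) → (∀ i : Fin N, MemLp (fun x => partialP i f x) 2 (Q.gibbsMeasure N T)) →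
          ∫ x, ((f x - f (x.1, -x.2)) / 2) ^ 2 ∂(Q.gibbsMeasure N T) ≤
            2 * T * ∑ i : Fin N, ∫ x, ((partialP i f x + partialP i f (x.1, -x.2)) / 2) ^ 2 ∂(Q.gibbsMeasure N T) := by
  sorry

/-- **Stub 4 — contact anchor (fixed `N ≥ 2`, difficulty M/L, theorem-in-waiting).**  For every regular
response density `h`: `ι_0 + ι_{N−1} = ‖∂_{p_0}h‖² + ‖∂_{p_{N−1}}h‖² ≤ 1/(2T³)` (the contact sum written with the
bath bookkeeping of `OscillatorChain.generator`).  Content: the stationary entropy balance of `μ_δ` relative to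
`μ_T` closed by Gibbs integration by parts (`integral_bath_mul_gibbsDensity`, `integral_generator_mul_gibbsDensity`):
`γ[T_L I_0 + T_R I_{N−1}](μ_δ|μ_T) = (δ/2T²)(γδ − 2J)` with `J = γ(T_L − ⟨p_0²⟩) = γ(⟨p_{N−1}²⟩ − T_R)`; at
order `δ²` this reads `γT(ι_0 + ι_{N−1}) = (γ/2 − G_N)/T²`, `G_N = J/δ + o(1)` the per-bond response, and
`G_N ≥ 0` (entropy production `J(1/T_R − 1/T_L) ≥ 0`, same balance relative to the bath Maxwellians) gives the
bound; EXACT at the harmonic corner (`0.375 = 0.5 − 0.125` at `ω₂ = γ = T = 1`, triage r1-1/2/3).  Uses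
`0 < γ` and `0 < T` (Disproof `_false_without_Tpos`). -/
theorem stub_contactAnchor :
    ∀ ω₂ lam β γ : ℝ, 0 < ω₂ → 0 < lam → 0 < β → 0 < γ →
          (∀ (N : ℕ) (T_L T_R : ℝ), 0 < T_L → 0 < T_R → ∀ μ ν : Measure (PhaseSpace N),
            (pinnedChain ω₂ lam β γ).IsSteadyState N T_L T_R μ → (pinnedChain ω₂ lam β γ).IsSteadyState N T_L T_R ν → μ = ν) →
          ∀ μ : (N : ℕ) → ℝ → ℝ → Measure (PhaseSpace N),
            (∀ (N : ℕ) (T_L T_R : ℝ), 0 < T_L → 0 < T_R → (pinnedChain ω₂ lam β γ).IsSteadyState N T_L T_R (μ N T_L T_R)) →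
            ∀ T : ℝ, 0 < T →
            ∀ (N : ℕ) (h : PhaseSpace N → ℝ), 2 ≤ N →
              (MemLp h 2 ((pinnedChain ω₂ lam β γ).gibbsMeasure N T) ∧
                (∀ F : PhaseSpace N → ℝ, ContDiff ℝ ((⊤ : ℕ∞) : WithTop ℕ∞) F → HasCompactSupport F →
                  Tendsto (fun δ : ℝ => ((∫ x, F x ∂(μ N (T + δ / 2) (T - δ / 2))) - ∫ x, F x ∂((pinnedChain ω₂ lam β γ).gibbsMeasure N T)) / δ)
                    (nhdsWithin 0 {(0 : ℝ)}ᶜ) (nhds (∫ x, F x * h x ∂((pinnedChain ω₂ lam β γ).gibbsMeasure N T)))) ∧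
                (∀ i : Fin N, Tendsto (fun δ : ℝ => ((∫ x, (pinnedChain ω₂ lam β γ).bondCurrent N i x ∂(μ N (T + δ / 2) (T - δ / 2))) -
                    ∫ x, (pinnedChain ω₂ lam β γ).bondCurrent N i x ∂((pinnedChain ω₂ lam β γ).gibbsMeasure N T)) / δ)
                    (nhdsWithin 0 {(0 : ℝ)}ᶜ) (nhds (∫ x, (pinnedChain ω₂ lam β γ).bondCurrent N i x * h x ∂((pinnedChain ω₂ lam β γ).gibbsMeasure N T))))) →
              ContDiff ℝ 1 h → (∀ i : Fin N, MemLp (fun x => partialP i h x) 2 ((pinnedChain ω₂ lam β γ).gibbsMeasure N T)) →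
              (∑ i : Fin N, if (i.val = 0 ∨ i.val = N - 1) then ∫ x, (partialP i h x) ^ 2 ∂((pinnedChain ω₂ lam β γ).gibbsMeasure N T) else 0) ≤ 1 / (2 * T ^ 3) := by
  sorry

/-- **Stub 5 — sensitivity maximum principle, weak/relative form (THE N-UNIFORM RESIDUAL; difficulty XL,
hardest).**  There is `C = C(ω₂,lam,β,γ,T)` such that for every `N ≥ 2`, every regular response density `h` and
EVERY site `i`: `ι_i^odd = ‖∂_{p_i} h_o‖² ≤ C · (ι_0 + ι_{N−1})` — no bulk momentum is more `δ`-sensitive (in the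
odd sector) than the two driven momenta together.  Physical reading: `ι_i ≈ θ_i²/T³` (`θ_i` the linear temperature
profile, `|θ_i| ≤ ½` = no overshoot) with the odd part `≈ (ℓ/N)²` smaller, while the contacts saturate
`ι_0 + ι_{N−1} → 1/(2T³)`; harmonic corner: flat `N`-independent odd plateau `1/12` vs contacts `0.375` (`C = 0.55`
suffices for `γ ∈ [0.05,5]`, ratio to the contact SUM ≤ 0.614 at weak coupling, triage r1-1).  Intended engine
(card K2): the closed first-variation system `L*k_i − γ1_∂(i)k_i = m_i − ∂_{p_i}g`, `L*m_i = −U″k_i − V″(k_i −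
k_{i±1})` (`[∂_{p_i},A] = ∂_{q_i}`, nearest-neighbour Hessian) and its energy identities — a comparison in the SITE
index; missing ingredient: bulk coercivity (`D(k_i)` is a contact Dirichlet form).  Why it might fail: an
`N`-uniform hypoelliptic-regularity statement one derivative beyond `ResponseDensity` for sites `~N/2` bonds from
any noise; a resonant bulk site / Kapitza layer could respond anomalously. -/
theorem stub_sensitivityMaximumPrinciple :
    ∀ ω₂ lam β γ : ℝ, 0 < ω₂ → 0 < lam → 0 < β → 0 < γ →
          (∀ (N : ℕ) (T_L T_R : ℝ), 0 < T_L → 0 < T_R → ∀ μ ν : Measure (PhaseSpace N),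
            (pinnedChain ω₂ lam β γ).IsSteadyState N T_L T_R μ → (pinnedChain ω₂ lam β γ).IsSteadyState N T_L T_R ν → μ = ν) →
          ∀ μ : (N : ℕ) → ℝ → ℝ → Measure (PhaseSpace N),
            (∀ (N : ℕ) (T_L T_R : ℝ), 0 < T_L → 0 < T_R → (pinnedChain ω₂ lam β γ).IsSteadyState N T_L T_R (μ N T_L T_R)) →
            ∀ T : ℝ, 0 < T →
            ∃ C : ℝ, ∀ (N : ℕ) (h : PhaseSpace N → ℝ), 2 ≤ N →
              (MemLp h 2 ((pinnedChain ω₂ lam β γ).gibbsMeasure N T) ∧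
                (∀ F : PhaseSpace N → ℝ, ContDiff ℝ ((⊤ : ℕ∞) : WithTop ℕ∞) F → HasCompactSupport F →
                  Tendsto (fun δ : ℝ => ((∫ x, F x ∂(μ N (T + δ / 2) (T - δ / 2))) - ∫ x, F x ∂((pinnedChain ω₂ lam β γ).gibbsMeasure N T)) / δ)
                    (nhdsWithin 0 {(0 : ℝ)}ᶜ) (nhds (∫ x, F x * h x ∂((pinnedChain ω₂ lam β γ).gibbsMeasure N T)))) ∧
                (∀ i : Fin N, Tendsto (fun δ : ℝ => ((∫ x, (pinnedChain ω₂ lam β γ).bondCurrent N i x ∂(μ N (T + δ / 2) (T - δ / 2))) -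
                    ∫ x, (pinnedChain ω₂ lam β γ).bondCurrent N i x ∂((pinnedChain ω₂ lam β γ).gibbsMeasure N T)) / δ)
                    (nhdsWithin 0 {(0 : ℝ)}ᶜ) (nhds (∫ x, (pinnedChain ω₂ lam β γ).bondCurrent N i x * h x ∂((pinnedChain ω₂ lam β γ).gibbsMeasure N T))))) →
              ContDiff ℝ 1 h → (∀ i : Fin N, MemLp (fun x => partialP i h x) 2 ((pinnedChain ω₂ lam β γ).gibbsMeasure N T)) →
              ∀ i : Fin N, (∫ x, ((partialP i h x + partialP i h (x.1, -x.2)) / 2) ^ 2 ∂((pinnedChain ω₂ lam β γ).gibbsMeasure N T)) ≤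
                C * (∑ i : Fin N, if (i.val = 0 ∨ i.val = N - 1) then ∫ x, (partialP i h x) ^ 2 ∂((pinnedChain ω₂ lam β γ).gibbsMeasure N T) else 0) := by
  sorry

/-! ## Composition (no sorry outside the stubs): the five stubs close the crux BY NAME -/

/-- Nonnegativity of the contact sensitivity (a finite sum of integrals of squares or zeros). -/
theorem contact_nonneg {N : ℕ} (ν : Measure (PhaseSpace N)) (h : PhaseSpace N → ℝ) :
    0 ≤ ∑ i : Fin N, (if (i.val = 0 ∨ i.val = N - 1) then ∫ x, (partialP i h x) ^ 2 ∂ν else 0) := by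
  refine Finset.sum_nonneg fun i _ => ?_
  split_ifs
  · exact integral_nonneg fun x => sq_nonneg _
  · exact le_rfl

/-- **The skeleton theorem.**  The five registered stubs imply the crux `ExtensiveSnapshotIrreversibility` (route
`BondHeatUncertainty`, item stmt-AtomisticToContinuum-9121) BY NAME, with the explicit constant
`C = 2 max C_mp 0 / T² + 1`; `N = 0, 1` by the landed Negative lemmas (`DegenerateInstances`).  Sorries ONLY inside
`stub_*`: with the five stubs replaced by hypotheses of the same types this proof term is closed (checked in the
planner folder: axioms `propext`, `Classical.choice`, `Quot.sound`). -/
theorem ExtensiveSnapshotIrreversibility_of :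
    Summit.AtomisticToContinuum.FouriersLaw.Theses.BondHeatUncertainty.ExtensiveSnapshotIrreversibility := by
  intro ω₂ lam β γ hω hl hβ hγ hU μ hμ T hT
  obtain ⟨Cmp, hmp⟩ := stub_sensitivityMaximumPrinciple ω₂ lam β γ hω hl hβ hγ hU μ hμ T hT
  -- the crux constant
  set C : ℝ := 2 * max Cmp 0 / T ^ 2 + 1 with hC_def
  have hT2 : 0 < T ^ 2 := by positivity
  have hT3 : 0 < T ^ 3 := by positivity
  have hC0 : 0 ≤ 2 * max Cmp 0 / T ^ 2 := div_nonneg (mul_nonneg (by norm_num) (le_max_right _ _)) hT2.le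
  refine ⟨C, fun N => ?_⟩
  rcases Nat.lt_or_ge N 2 with hN | hN
  · -- N = 0, 1: landed Negative lemmas
    interval_cases N
    · exact extensiveSnapshotIrreversibility_bound_at_zero hμ hT C
    · exact extensiveSnapshotIrreversibility_bound_at_one hω hl hβ hU hμ hT C
  · -- N ≥ 2: the chain of the line
    -- Stub 1: a regular response density
    obtain ⟨h, hRD, hC1, hgrad⟩ := stub_regularResponseDensity ω₂ lam β γ hω hl hβ hγ hU μ hμ T hT N hN
    -- Stub 4: contact anchor
    have hA := stub_contactAnchor ω₂ lam β γ hω hl hβ hγ hU μ hμ T hT N h hN hRD hC1 hgrad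
    -- Stub 5: maximum principle, site by site
    have hM := hmp N h hN hRD hC1 hgrad
    -- Stub 3: fibrewise Poincaré for the odd part of h
    have hP := stub_oddFibrePoincare (pinnedChain ω₂ lam β γ) N T hT h hC1 hRD.1 hgrad
    -- abbreviations
    set B : ℝ := ∑ i : Fin N, (if (i.val = 0 ∨ i.val = N - 1) then
        ∫ x, (partialP i h x) ^ 2 ∂((pinnedChain ω₂ lam β γ).gibbsMeasure N T) else 0) with hB_def
    have hB0 : 0 ≤ B := contact_nonneg _ h
    -- each odd sensitivity is at most max(Cmp,0)/(2T³)
    have hsite : ∀ i : Fin N,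
        (∫ x, ((partialP i h x + partialP i h (x.1, -x.2)) / 2) ^ 2
            ∂((pinnedChain ω₂ lam β γ).gibbsMeasure N T)) ≤ max Cmp 0 * (1 / (2 * T ^ 3)) := by
      intro i
      calc (∫ x, ((partialP i h x + partialP i h (x.1, -x.2)) / 2) ^ 2
              ∂((pinnedChain ω₂ lam β γ).gibbsMeasure N T)) ≤ Cmp * B := hM i
        _ ≤ max Cmp 0 * B := mul_le_mul_of_nonneg_right (le_max_left _ _) hB0
        _ ≤ max Cmp 0 * (1 / (2 * T ^ 3)) := mul_le_mul_of_nonneg_left hA (le_max_right _ _)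
    -- sum over the N sites
    have hsum : (∑ i : Fin N, ∫ x, ((partialP i h x + partialP i h (x.1, -x.2)) / 2) ^ 2
            ∂((pinnedChain ω₂ lam β γ).gibbsMeasure N T)) ≤ (N : ℝ) * (max Cmp 0 * (1 / (2 * T ^ 3))) := by
      calc (∑ i : Fin N, ∫ x, ((partialP i h x + partialP i h (x.1, -x.2)) / 2) ^ 2
              ∂((pinnedChain ω₂ lam β γ).gibbsMeasure N T))
            ≤ ∑ _i : Fin N, max Cmp 0 * (1 / (2 * T ^ 3)) := Finset.sum_le_sum fun i _ => hsite i
        _ = (N : ℝ) * (max Cmp 0 * (1 / (2 * T ^ 3))) := by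
            rw [Finset.sum_const, Finset.card_univ, Fintype.card_fin, nsmul_eq_mul]
    -- hence 2‖h_o‖² ≤ N · 2 max(Cmp,0)/T² < C · N
    have hN1 : (1 : ℝ) ≤ N := by exact_mod_cast (le_trans (by norm_num) hN : 1 ≤ N)
    have hkey : 2 * (∫ x, ((h x - h (x.1, -x.2)) / 2) ^ 2
        ∂((pinnedChain ω₂ lam β γ).gibbsMeasure N T)) < C * (N : ℝ) := by
      have h1 : 2 * (∫ x, ((h x - h (x.1, -x.2)) / 2) ^ 2
          ∂((pinnedChain ω₂ lam β γ).gibbsMeasure N T)) ≤ (N : ℝ) * (2 * max Cmp 0 / T ^ 2) := by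
        have h2T : (0 : ℝ) ≤ 2 * T := by positivity
        have h2 := mul_le_mul_of_nonneg_left (hP.trans (mul_le_mul_of_nonneg_left hsum h2T))
          (by norm_num : (0 : ℝ) ≤ 2)
        refine h2.trans (le_of_eq ?_)
        field_simp
      have h3 : (N : ℝ) * (2 * max Cmp 0 / T ^ 2) < C * (N : ℝ) := by
        rw [hC_def]
        nlinarith
      exact lt_of_le_of_lt h1 h3
    -- Stub 2: the eventual KL bound with K = C · N
    exact stub_klUpperBound ω₂ lam β γ hω hl hβ hγ hU μ hμ T hT N h hRD (C * (N : ℝ)) hkey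

end Summit.AtomisticToContinuum.FouriersLaw.Cruxes.ExtensiveSnapshotIrreversibility.MomentumFisherMaximumPrinciple

end
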